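import Summits.HodgeConjecture.HodgeConjecture.Theorems.R90S4PlainWeylMeasure          -- ★ p863297 (K2E3-p12 g10) (B2-P): `IsPlainWeylMeasure`, `exists_isPlainWeylMeasure` (print p. 182, first display, unconditional)
import Summits.HodgeConjecture.HodgeConjecture.Theorems.R90S4NormSectionOfRegular       -- ★ p863172 (this seat): `exists_normSection_forall_isNormSection` (global norm section; B3₀ on every regular-carried `ρ`)
import HarnessLib

/-!
# R90-TF · S4 «Ch. 13.1–2», (1D-CT) road — TWO OF THE THREE TORUS-SIDE INGREDIENTS, UNCONDITIONALLY AND TOGETHER: the plain Weyl measure `ρ₀` of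
# `U(Φ₃)(L⁺_v)` carries a norm section (Rogawski 1990, §12.5 pp. 182, 186; §3.11 Prop. 3.11.1 (b) p. 34)

Cell `hodgecm-mathlib`, crux H413 (`stmt-HodgeConjecture-24833`, lane `--supports … --as helper`), route of record `HCCMUnconditional` (no route verbs;
count-neutral).  Programme R90-TF, section S4 = [Rogawski1990] Ch. 13.1–13.2; seat R90-C131-p03 (g2) (S4 dealer seat vacant; composition check of this
seat's ★ NORM-TORI chain with K2E3-p12 (g10)'s ★ (B2-P)).  THEOREMS ONLY — no `def`, no instance, no notation, no named-fact hypothesis, no `sorry`; ★-only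
imports (two S4 `Theorems` files), never `Lines`.

HONEST LABEL: HC_CM is proved only modulo the 7 printed citations (2 remaining named inputs: hLiu418 = stmt-HodgeConjecture-24832, h413 =
stmt-HodgeConjecture-24833) until rung 0 closes.  Discharges no socket: of the proposed (W-NP) cut `∃ ρ sec, IsStableWeylMeasure ∧ IsTwistedWeylMeasure ∧
IsNormSection` of (1D-CT), this file supplies — for the PLAIN (not yet stable) Weyl measure — the first and third ingredients jointly and unconditionally; the
stable regrouping (B2-S) and the twisted formula (B1 T-WIF) remain OPEN (REL ≠ ★ ≠ BUILT).

## The mathematics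

★ `exists_isPlainWeylMeasure` (p. 182, first display): at a non-split `v`, for a bi-invariant Haar measure `νG` on `G_v = U(Φ₃)(L⁺_v)` and a canonical orbital
family `mG`, there is a measure `ρ₀` on `G_v`, carried by the regular set, with `∫ f α dνG = ∫ Φ(γ, f) α(γ) dρ₀` for test functions `f` and continuous class
functions `α`.  ★ `exists_normSection_forall_isNormSection` (Prop. 3.11.1 (b), this seat's B3-3 ∕ B3₀): ONE section `sec : G_v → G̃_v` of the norm map with
`N(sec γ) = γ` for every `γ`, which is a norm section (★ `IsNormSection`: `sec γ` ε-regular with `γ ∈ 𝒩(sec γ)`, `ρ`-a.e.) over EVERY `ρ` carried by the regular set.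
Hence **`exists_plainWeylMeasure_normSection`**: `∃ ρ₀ sec, IsPlainWeylMeasure … ρ₀ ∧ IsNormSection … ρ₀ sec ∧ (∀ᵐ γ ∂ρ₀, γ regular) ∧ ∀ γ, N(sec γ) = γ`.

[cite: Rogawski1990, §12.5 pp. 182, 186; §3.11 Prop. 3.11.1 (b) p. 34]
-/

set_option autoImplicit false
-- the mandated namespace repeats the single-problem summit's segment (`HodgeConjecture.HodgeConjecture`)
set_option linter.dupNamespace false

noncomputable section

open MeasureTheory
open scoped NumberField Matrix MatrixGroups

namespace Summit.HodgeConjecture.HodgeConjecture.R90.S4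

open Literature.NumberTheory.Rogawski1990 Literature.NumberTheory.Rogawski1990.Ch4Sec10
open Literature.NumberTheory.Automorphic Literature.NumberTheory.Automorphic.UnitaryGroup
open IsDedekindDomain NumberField

variable (L : Type) [Field L] [NumberField L] [IsCMField L] (v : HeightOneSpectrum (𝓞 ↥(maximalRealSubfield L)))

/-- **THE PLAIN WEYL MEASURE CARRIES A NORM SECTION** (non-split `v`, form of record `splitFormGL L`): for a bi-invariant Haar measure `νG` on `U(Φ₃)(L⁺_v)` and a
canonical orbital family `mG` there are a measure `ρ₀` and a section `sec` of the norm map with (i) `ρ₀` a plain Weyl measure for `(νG, mG)` (★ `exists_isPlainWeylMeasure`,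
p. 182), (ii) `sec` a norm section over `ρ₀` (★ `IsNormSection`; from ★ `exists_normSection_forall_isNormSection`, Prop. 3.11.1 (b)), (iii) `ρ₀` carried by the regular
set, (iv) `N(sec γ) = γ` for EVERY `γ`.  Two of the three ingredients of the (W-NP) cut of (1D-CT) — for the plain formula; the stable regrouping and T-WIF remain.
[cite: Rogawski1990, §12.5 pp. 182, 186; §3.11 Prop. 3.11.1 (b) p. 34] -/
theorem exists_plainWeylMeasure_normSection (hns : ∀ w : PlacesOver L v, IsCMField.complexConj L • w.1 = w.1)
    [MeasurableSpace (Gqs L v)] [BorelSpace (Gqs L v)]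
    [∀ γ' : Gqs L v, MeasurableSpace (Gqs L v ⧸ Subgroup.centralizer ({γ'} : Set (Gqs L v)))]
    [∀ γ' : Gqs L v, BorelSpace (Gqs L v ⧸ Subgroup.centralizer ({γ'} : Set (Gqs L v)))]
    (νG : Measure (Gqs L v)) [νG.IsHaarMeasure] [νG.IsMulRightInvariant]
    (mG : OrbitalMeasureFamily (Gqs L v)) (hcan : mG.IsCanonical (fun γ : Gqs L v => IsRegularElt (γ.val : GL (Fin 3) (LocalRing L v))) νG) :
    ∃ (ρ₀ : Measure (Gqs L v)) (sec : Gqs L v → GtLoc L v),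
      IsPlainWeylMeasure L (splitFormGL L) v νG mG ρ₀ ∧ IsNormSection L (splitFormGL L) v ρ₀ sec ∧
        (∀ᵐ γ ∂ρ₀, IsRegularElt (γ.val : GL (Fin 3) (LocalRing L v))) ∧
          ∀ γ : Gqs L v, epsNorm (epsLoc L (splitFormGL L) v) (sec γ) = γ.val := by
  obtain ⟨ρ₀, hρ₀, hreg⟩ := exists_isPlainWeylMeasure L v hns νG mG hcan
  obtain ⟨sec, hN, hsec⟩ := exists_normSection_forall_isNormSection L (splitFormGL L) v
  exact ⟨ρ₀, sec, hρ₀, hsec ρ₀ hreg, hreg, hN⟩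

end Summit.HodgeConjecture.HodgeConjecture.R90.S4

end
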